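import Literature.Topology.FourManifolds.Trisections
import Literature.Topology.FourManifolds.MorseBirthInsertion
import Literature.Topology.FourManifolds.NiceMorseFunctionsRearrangement
import Literature.Topology.FourManifolds.SPC4HandlesSelfIndexingProofs
import Literature.Topology.FourManifolds.HCobordismTheoremProofs
import HarnessLib

/-!
# Existence of trisections (Gay–Kirby 2016, Thm. 4): the printed architecture, and its first
# two steps proved (balanced nice handle decompositions of closed `4`-manifolds)

Topic `Literature/Topology/FourManifolds`; sibling of `Trisections.lean` (fact seat
`provefact-Literature.Topology.FourManifolds.exists_isBalancedGKTrisection`).  The target of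
that seat is the named fact `Literature.Topology.FourManifolds.exists_isBalancedGKTrisection`: *every closed, connected,
oriented smooth `4`-manifold admits a `(g, k)`-trisection with `0 ≤ k ≤ g`* (Gay–Kirby,
*Trisecting 4-manifolds*, Geom. Topol. 20 (2016), Thm. 4; over the corrected predicate
`IsBalancedGKTrisection`, sectors with corners along the central surface).  A sorry-free proof
from Mathlib is a theory (handle decompositions of closed `4`-manifolds, Heegaard splittings of
`∂X₁` adapted to the attaching link of the `2`-handles, Gay–Kirby's Lemma 14 with explicit
corner charts); this file records the **printed proof's architecture** (the handle-theoretic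
proof of §4 *Trisections and handle decompositions*; chunks 13–14 of the held TeX text
`paper:arxiv-1205.1565`) and **proves its first two steps**:

> *Proof of Theorem 4.*  Start with a handle decomposition of `X⁴` with one `0`-handle, `k₁`
> `1`-handles, `k₂` `2`-handles, `k₃` `3`-handles and one `4`-handle.  Add cancelling `1`–`2`
> and `2`–`3` pairs if necessary so as to arrange that `k₁ = k₃`.  Let `X₁` be the union of the
> `0`-handle and the `1`-handles. […] we now satisfy the hypotheses of Lemma 14 and apply that
> lemma to produce our trisection.

In the tree's Morse-theoretic handle vocabulary (`Morse.lean`, `Handles.lean`: a handle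
decomposition of a closed manifold with the handles attached in order of increasing index is a
self-indexing Morse function, Smale 1961 / Milnor 1965 Thm. 4.8 and Def. 4.9, its `λ`-handles
being the critical points of index `λ`) the printed steps are:

1. **A handle decomposition with one `0`-handle and one `4`-handle** — the tree's named fact
   `Literature.Topology.FourManifolds.exists_isMorse_isSelfIndexing 4` (`SPC4Handles.lean`; Smale 1961, Milnor 1965
   Thms. 4.8 and 8.1), whose own DAG is reduced in the tree to the single leaf
   `Cobordism.Milnor1965_cancellation_modelChart` (Milnor 1965, proof of Thm. 5.4,
   Assertion 6; `SPC4HandlesSelfIndexingProofs.lean`) — a leaf that is now **discharged**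
   (`Cobordism.Milnor1965_cancellation_modelChart_holds`, `HCobordismTheoremProofs.lean`),
   whence the fact itself (`exists_isMorse_isSelfIndexing_holds`,
   `SPC4HandlesSelfIndexingProofs.lean`).
2. **Balancing, `k₁ = k₃`, by adding cancelling pairs** — **proved here**
   (`exists_isSelfIndexing_ncard_one_eq_ncard_three`, from step 1's fact;
   `exists_isSelfIndexing_ncard_one_eq_ncard_three_of_modelChart`, from Milnor's Assertion 6
   leaf; `exists_isSelfIndexing_balanced`, **unconditionally**, from step 1's discharge):
   insert `|k₁ - k₃|` pairs of auxiliary nondegenerate critical points of indices `(1, 2)` or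
   `(2, 3)` at regular points (Milnor 1965, Lemma 8.2 and the insertion step of
   the proof of Thm. 8.1 — the tree's proved `IsMorse.exists_insert_birthPair`,
   `MorseBirthInsertion.lean`; one pair: `exists_isSelfIndexing_ncard_add_pair`, `d` pairs:
   `exists_isSelfIndexing_ncard_add_pairs`), and make the function self-indexing again
   without changing critical points or indices (Milnor 1965, Thm. 4.8 — the tree's proved
   `Cobordism.Milnor1965_finalRearrangement_holds` through
   `exists_isSelfIndexing_criticalSet_eq_of_finalRearrangement`).  A regular point exists by
   the intermediate value theorem between the minimum (level `0`) and the maximum (level `4`):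
   the level `1/2` is not an integer (`exists_not_isMCriticalPt_of_isSelfIndexing`).
3. **The trisection from a balanced handle decomposition** — the rest of the printed proof:
   the genus-`k₁` Heegaard splitting of `∂X₁ = #^{k₁}(S¹ × S²)`, projection of the framed
   attaching link `L` of the `2`-handles onto the Heegaard surface with `c` crossings, `k₂`
   resp. `2c - k₂` stabilisations and `c - k₂` further cancelling pairs of each kind, then
   Lemma 14 (`X₂ = [0, ε] × H₁₂ ∪` `2`-handles, `X₃` the rest; the `2`-handles cancel `g - k`
   of the `S¹ × B³` summands).  Its outcome, as printed, is a `(k₁ + k₂ + 3m, k₁ + m)`-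
   trisection with `m = max (0, c - k₂)` (*"Letting `k = k₁` and `g = k₁ + k₂`"*;
   *"`k'₁ = k₁ + c - k₂` […] `g' = k'₁ + 2c - k₂`"*), whence Thm. 4's `k ≤ g`.  This step is
   **not vendored here**: it is itself theory-sized, and its decomposition (Lemma 14; the
   link-projection paragraph) needs vocabulary the tree does not have yet — Heegaard
   splittings of a level set *as subsets*, the framed attaching link of the `2`-handles,
   isotopy of framed links in `H₁₂`, systems of compressing discs and geometric duality on the
   Heegaard surface.  Under D-0026 a proving seat does not introduce it as a new named fact;
   the seat's notes carry the statement (a closed connected oriented `X` *given with* a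
   balanced nice Morse function with `(1, k₁, k₂, k₁, 1)` critical points of indices `0, …, 4`
   admits a `(k₁ + k₂ + 3m, k₁ + m)`-trisection over `IsBalancedGKTrisection` for some `m`) and
   the three-line assembly of the target from it and step 2.

## References

* D. Gay, R. Kirby, *Trisecting 4-manifolds*, Geom. Topol. 20 (2016) 3097–3132
  (arXiv:1205.1565, held as `paper:arxiv-1205.1565`, TeX text in 18 chunks): Def. 1 and Thm. 4
  (§1, chunk 3), §4: Lemma 13, Lemma 14 and the proof of Thm. 4 (chunks 13–14). [GayKirby2016]
* J. Milnor, *Lectures on the h-cobordism theorem*, Princeton Math. Notes (1965): Thm. 4.8 and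
  Def. 4.9 (self-indexing), Lemma 8.2 and the proof of Thm. 8.1 (insertion of an auxiliary
  pair), Thm. 5.4 and its proof (Assertion 6). [MilnorHCobordism1965]
* S. Smale, *On gradient dynamical systems*, Ann. of Math. 74 (1961) (nice functions). [Smale1961]
-/

open scoped Manifold ContDiff Topology
open Set Function

noncomputable section

namespace Literature.Topology.FourManifolds

universe u

/-! ### Step 2 of the printed proof, proved: balancing the `1`- and `3`-handles -/

section Balancing

variable {X : Type u} [TopologicalSpace X] [T2Space X] [SecondCountableTopology X]
  [ChartedSpace (EuclideanSpace ℝ (Fin 4)) X] [IsManifold (𝓡 4) ∞ X] [CompactSpace X]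
  [ConnectedSpace X]

omit [T2Space X] [SecondCountableTopology X] [IsManifold (𝓡 4) ∞ X] [CompactSpace X] in
/-- A self-indexing Morse function on a closed connected `4`-manifold with a critical point of
index `0` (on the level `0`) and one of index `4` (on the level `4`) has a regular point: by the
intermediate value theorem the level `1/2` is nonempty, and it carries no critical point since
critical values of a self-indexing function are integers (Milnor 1965, Def. 4.9 and §8: the
levels `k + 1/2` are regular). [cite: MilnorHCobordism1965, Def. 4.9 and §8] -/
theorem exists_not_isMCriticalPt_of_isSelfIndexing {f : X → ℝ} (hf : IsMorse (𝓡 4) f)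
    (hsi : IsSelfIndexing (𝓡 4) f) (h0 : (criticalSetOfIndex (𝓡 4) f 0).ncard = 1)
    (h4 : (criticalSetOfIndex (𝓡 4) f 4).ncard = 1) : ∃ z, ¬ IsMCriticalPt (𝓡 4) f z := by
  obtain ⟨x₀, hx₀⟩ := Set.ncard_eq_one.1 h0
  obtain ⟨x₄, hx₄⟩ := Set.ncard_eq_one.1 h4
  have hx₀m : x₀ ∈ criticalSetOfIndex (𝓡 4) f 0 := by rw [hx₀]; exact mem_singleton _
  have hx₄m : x₄ ∈ criticalSetOfIndex (𝓡 4) f 4 := by rw [hx₄]; exact mem_singleton _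
  have hf₀ : f x₀ = 0 := by rw [hsi x₀ hx₀m.1, hx₀m.2, Nat.cast_zero]
  have hf₄ : f x₄ = 4 := by rw [hsi x₄ hx₄m.1, hx₄m.2]; norm_num
  obtain ⟨z, hz⟩ : (1 / 2 : ℝ) ∈ range f :=
    intermediate_value_univ x₀ x₄ hf.1.continuous ⟨by rw [hf₀]; norm_num, by rw [hf₄]; norm_num⟩
  refine ⟨z, hsi.not_isMCriticalPt_of_forall_ne fun m hm => ?_⟩
  rw [hz] at hm
  have h2 : ((2 * m : ℕ) : ℝ) = 1 := by push_cast; rw [← hm]; norm_num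
  have h2' : 2 * m = 1 := by exact_mod_cast h2
  omega

/-- **Inserting one cancelling pair of handles of indices `k`, `k + 1`** (Gay–Kirby: *"Add
cancelling `1`–`2` and `2`–`3` pairs"*), at the level of nice Morse functions: given a
self-indexing Morse function on a closed connected `4`-manifold with one critical point of index
`0` and one of index `4`, there is another one whose numbers of critical points of each index are
the old ones, plus one in index `k` and one in index `k + 1`.  Mechanism: Milnor 1965, Lemma 8.2
and the insertion step of the proof of Thm. 8.1 (`Literature.Topology.FourManifolds.IsMorse.exists_insert_birthPair`) at a
regular point, followed by the final rearrangement theorem Thm. 4.8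
(`Literature.Topology.FourManifolds.exists_isSelfIndexing_criticalSet_eq_of_finalRearrangement`,
`Literature.Topology.FourManifolds.Cobordism.Milnor1965_finalRearrangement_holds`), which restores self-indexing without
changing critical points or indices.
[cite: MilnorHCobordism1965, Lemma 8.2, proof of Thm. 8.1 (insertion of an auxiliary pair) and Thm. 4.8] -/
theorem exists_isSelfIndexing_ncard_add_pair {f : X → ℝ} (hf : IsMorse (𝓡 4) f)
    (hsi : IsSelfIndexing (𝓡 4) f) (h0 : (criticalSetOfIndex (𝓡 4) f 0).ncard = 1)
    (h4 : (criticalSetOfIndex (𝓡 4) f 4).ncard = 1) {k : ℕ} (hk : k < 4) :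
    ∃ g : X → ℝ, IsMorse (𝓡 4) g ∧ IsSelfIndexing (𝓡 4) g ∧
      ∀ i, (criticalSetOfIndex (𝓡 4) g i).ncard =
        (criticalSetOfIndex (𝓡 4) f i).ncard + (if i = k then 1 else 0) +
          (if i = k + 1 then 1 else 0) := by
  obtain ⟨z, hz⟩ := exists_not_isMCriticalPt_of_isSelfIndexing hf hsi h0 h4
  obtain ⟨g₁, hg₁, -, -, -, hidx, q, r, -, -, hqr, hq, hr, hcrit, hiq, hir, -⟩ :=
    hf.exists_insert_birthPair (I := 𝓡 4) BoundarylessManifold.isInteriorPoint hz Filter.univ_mem hk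
      one_pos
  -- the counts of `g₁`
  have hfin : (criticalSet (𝓡 4) f).Finite := IsMorse.finite_criticalSet_holds hf
  have hfin' : ∀ i, (criticalSetOfIndex (𝓡 4) f i).Finite := fun i =>
    hfin.subset (criticalSetOfIndex_subset _ f i)
  have hmem : ∀ i x, x ∈ criticalSetOfIndex (𝓡 4) g₁ i ↔
      (x = q ∧ k = i) ∨ (x = r ∧ k + 1 = i) ∨ x ∈ criticalSetOfIndex (𝓡 4) f i := by
    intro i x
    have hx : IsMCriticalPt (𝓡 4) g₁ x ↔ x ∈ criticalSet (𝓡 4) g₁ := Iff.rfl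
    simp only [mem_criticalSetOfIndex, hx, hcrit, mem_insert_iff, mem_criticalSet]
    constructor
    · rintro ⟨hx | hx | hx, hi⟩
      · subst hx; exact Or.inl ⟨rfl, hiq ▸ hi⟩
      · subst hx; exact Or.inr (Or.inl ⟨rfl, hir ▸ hi⟩)
      · exact Or.inr (Or.inr ⟨hx, (hidx x hx) ▸ hi⟩)
    · rintro (⟨rfl, hi⟩ | ⟨rfl, hi⟩ | ⟨hx', hi⟩)
      · exact ⟨Or.inl rfl, hiq.trans hi⟩
      · exact ⟨Or.inr (Or.inl rfl), hir.trans hi⟩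
      · exact ⟨Or.inr (Or.inr hx'), (hidx x hx').trans hi⟩
  have hqi : ∀ i, q ∉ criticalSetOfIndex (𝓡 4) f i := fun i hqm => hq hqm.1
  have hri : ∀ i, r ∉ criticalSetOfIndex (𝓡 4) f i := fun i hrm => hr hrm.1
  have hcount : ∀ i, (criticalSetOfIndex (𝓡 4) g₁ i).ncard =
      (criticalSetOfIndex (𝓡 4) f i).ncard + (if i = k then 1 else 0) +
        (if i = k + 1 then 1 else 0) := by
    intro i
    by_cases hik : i = k
    · subst hik
      have hne : i ≠ i + 1 := by omega
      have he : criticalSetOfIndex (𝓡 4) g₁ i = insert q (criticalSetOfIndex (𝓡 4) f i) := by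
        ext x
        rw [hmem, mem_insert_iff]
        constructor
        · rintro (⟨rfl, -⟩ | ⟨-, h⟩ | h)
          · exact Or.inl rfl
          · exact absurd h.symm hne
          · exact Or.inr h
        · rintro (rfl | h)
          · exact Or.inl ⟨rfl, rfl⟩
          · exact Or.inr (Or.inr h)
      rw [he, Set.ncard_insert_of_notMem (hqi i) (hfin' i), if_pos rfl, if_neg hne]
    · by_cases hik' : i = k + 1
      · subst hik'
        have he : criticalSetOfIndex (𝓡 4) g₁ (k + 1) =
            insert r (criticalSetOfIndex (𝓡 4) f (k + 1)) := by
          ext x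
          rw [hmem, mem_insert_iff]
          constructor
          · rintro (⟨-, h⟩ | ⟨rfl, -⟩ | h)
            · exact absurd h.symm hik
            · exact Or.inl rfl
            · exact Or.inr h
          · rintro (rfl | h)
            · exact Or.inr (Or.inl ⟨rfl, rfl⟩)
            · exact Or.inr (Or.inr h)
        rw [he, Set.ncard_insert_of_notMem (hri _) (hfin' _), if_neg hik, if_pos rfl]
      · have he : criticalSetOfIndex (𝓡 4) g₁ i = criticalSetOfIndex (𝓡 4) f i := by
          ext x
          rw [hmem]
          constructor
          · rintro (⟨-, h⟩ | ⟨-, h⟩ | h)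
            · exact absurd h.symm hik
            · exact absurd h.symm hik'
            · exact h
          · exact fun h => Or.inr (Or.inr h)
        rw [he, if_neg hik, if_neg hik']; simp
  -- restore self-indexing (Milnor 1965, Thm. 4.8), keeping critical points and indices
  obtain ⟨g, hg, hgsi, hgcrit, hgidx⟩ :=
    exists_isSelfIndexing_criticalSet_eq_of_finalRearrangement
      Cobordism.Milnor1965_finalRearrangement_holds 4 X g₁ hg₁
  exact ⟨g, hg, hgsi, fun i => (ncard_criticalSetOfIndex_congr hgcrit hgidx i).trans (hcount i)⟩

/-- Iterating `exists_isSelfIndexing_ncard_add_pair`: `d` cancelling pairs of indices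
`k`, `k + 1` can be added to a nice handle decomposition of a closed connected `4`-manifold
(Gay–Kirby: *"Add cancelling `1`–`2` and `2`–`3` pairs if necessary"*).
[cite: GayKirby2016, proof of Thm. 4 in §4, second sentence] -/
theorem exists_isSelfIndexing_ncard_add_pairs {f : X → ℝ} (hf : IsMorse (𝓡 4) f)
    (hsi : IsSelfIndexing (𝓡 4) f) (h0 : (criticalSetOfIndex (𝓡 4) f 0).ncard = 1)
    (h4 : (criticalSetOfIndex (𝓡 4) f 4).ncard = 1) {k : ℕ} (hk1 : 1 ≤ k) (hk : k + 1 < 4)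
    (d : ℕ) :
    ∃ g : X → ℝ, IsMorse (𝓡 4) g ∧ IsSelfIndexing (𝓡 4) g ∧
      ∀ i, (criticalSetOfIndex (𝓡 4) g i).ncard =
        (criticalSetOfIndex (𝓡 4) f i).ncard + (if i = k then d else 0) +
          (if i = k + 1 then d else 0) := by
  induction d with
  | zero => exact ⟨f, hf, hsi, fun i => by simp⟩
  | succ d ih =>
    obtain ⟨g, hg, hgsi, hgc⟩ := ih
    have hg0 : (criticalSetOfIndex (𝓡 4) g 0).ncard = 1 := by
      rw [hgc 0, h0, if_neg (by omega), if_neg (by omega)]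
    have hg4 : (criticalSetOfIndex (𝓡 4) g 4).ncard = 1 := by
      rw [hgc 4, h4, if_neg (by omega), if_neg (by omega)]
    obtain ⟨g', hg', hg'si, hg'c⟩ := exists_isSelfIndexing_ncard_add_pair hg hgsi hg0 hg4
      (k := k) (by omega)
    refine ⟨g', hg', hg'si, fun i => ?_⟩
    rw [hg'c i, hgc i]
    split_ifs <;> omega

/-- **Steps 1–2 of Gay–Kirby's proof of Thm. 4** (*"Start with a handle decomposition of `X⁴`
with one `0`-handle, `k₁` `1`-handles, `k₂` `2`-handles, `k₃` `3`-handles and one `4`-handle.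
Add cancelling `1`–`2` and `2`–`3` pairs if necessary so as to arrange that `k₁ = k₃`"*),
**proved** from the tree's named fact `Literature.Topology.FourManifolds.exists_isMorse_isSelfIndexing 4` (Smale 1961;
Milnor 1965, Thms. 4.8 and 8.1): every closed connected smooth `4`-manifold carries a
self-indexing Morse function with exactly one critical point of index `0`, one of index `4`,
and as many of index `1` as of index `3` — if `k₁ ≤ k₃` insert `k₃ - k₁` pairs of indices
`(1, 2)`, otherwise `k₁ - k₃` pairs of indices `(2, 3)` (`exists_isSelfIndexing_ncard_add_pairs`).
[cite: GayKirby2016, proof of Thm. 4 in §4, first two sentences] -/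
theorem exists_isSelfIndexing_ncard_one_eq_ncard_three
    (hSI : FourManifolds.exists_isMorse_isSelfIndexing.{u} 4) (X : Type u) [TopologicalSpace X]
    [T2Space X] [SecondCountableTopology X] [ChartedSpace (EuclideanSpace ℝ (Fin 4)) X]
    [IsManifold (𝓡 4) ∞ X] [CompactSpace X] [ConnectedSpace X] :
    ∃ f : X → ℝ, IsMorse (𝓡 4) f ∧ IsSelfIndexing (𝓡 4) f ∧
      (criticalSetOfIndex (𝓡 4) f 0).ncard = 1 ∧ (criticalSetOfIndex (𝓡 4) f 4).ncard = 1 ∧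
      (criticalSetOfIndex (𝓡 4) f 1).ncard = (criticalSetOfIndex (𝓡 4) f 3).ncard := by
  obtain ⟨f, hf, hsi, h0, h4⟩ := hSI X
  rcases le_total (criticalSetOfIndex (𝓡 4) f 1).ncard (criticalSetOfIndex (𝓡 4) f 3).ncard
    with h13 | h31
  · -- add `k₃ - k₁` cancelling `1`–`2` pairs
    obtain ⟨g, hg, hgsi, hgc⟩ := exists_isSelfIndexing_ncard_add_pairs hf hsi h0 h4 (k := 1)
      le_rfl (by norm_num)
      ((criticalSetOfIndex (𝓡 4) f 3).ncard - (criticalSetOfIndex (𝓡 4) f 1).ncard)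
    refine ⟨g, hg, hgsi, ?_, ?_, ?_⟩
    · rw [hgc 0, h0]; simp
    · rw [hgc 4, h4]; simp
    · rw [hgc 1, hgc 3]; split_ifs <;> omega
  · -- add `k₁ - k₃` cancelling `2`–`3` pairs
    obtain ⟨g, hg, hgsi, hgc⟩ := exists_isSelfIndexing_ncard_add_pairs hf hsi h0 h4 (k := 2)
      (by norm_num) (by norm_num)
      ((criticalSetOfIndex (𝓡 4) f 1).ncard - (criticalSetOfIndex (𝓡 4) f 3).ncard)
    refine ⟨g, hg, hgsi, ?_, ?_, ?_⟩
    · rw [hgc 0, h0]; simp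
    · rw [hgc 4, h4]; simp
    · rw [hgc 1, hgc 3]; split_ifs <;> omega

/-- **Steps 1–2 of Gay–Kirby's proof of Thm. 4 from Milnor's Assertion 6 alone.**  With the
tree's reduction of `exists_isMorse_isSelfIndexing` to the general case of Assertion 6 of the
proof of Milnor's First Cancellation Theorem 5.4 (`Literature.Topology.FourManifolds.exists_isMorse_isSelfIndexing_of_modelChart`,
`SPC4HandlesSelfIndexingProofs.lean`), the balanced nice Morse function of
`exists_isSelfIndexing_ncard_one_eq_ncard_three` exists on every closed connected smooth
`4`-manifold granted the single named fact `Cobordism.Milnor1965_cancellation_modelChart`.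
[cite: GayKirby2016, proof of Thm. 4 in §4, first two sentences]
[cite: MilnorHCobordism1965, proof of Thm. 5.4, Assertion 6 (PDF pp. 30–32)] -/
theorem exists_isSelfIndexing_ncard_one_eq_ncard_three_of_modelChart
    (hE : Cobordism.Milnor1965_cancellation_modelChart.{u}) (X : Type u) [TopologicalSpace X]
    [T2Space X] [SecondCountableTopology X] [ChartedSpace (EuclideanSpace ℝ (Fin 4)) X]
    [IsManifold (𝓡 4) ∞ X] [CompactSpace X] [ConnectedSpace X] :
    ∃ f : X → ℝ, IsMorse (𝓡 4) f ∧ IsSelfIndexing (𝓡 4) f ∧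
      (criticalSetOfIndex (𝓡 4) f 0).ncard = 1 ∧ (criticalSetOfIndex (𝓡 4) f 4).ncard = 1 ∧
      (criticalSetOfIndex (𝓡 4) f 1).ncard = (criticalSetOfIndex (𝓡 4) f 3).ncard :=
  exists_isSelfIndexing_ncard_one_eq_ncard_three (exists_isMorse_isSelfIndexing_of_modelChart hE 4) X

/-- **Steps 1–2 of Gay–Kirby's proof of Thm. 4, unconditionally** (*"Start with a handle
decomposition of `X⁴` with one `0`-handle, `k₁` `1`-handles, `k₂` `2`-handles, `k₃` `3`-handles
and one `4`-handle.  Add cancelling `1`–`2` and `2`–`3` pairs if necessary so as to arrange that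
`k₁ = k₃`"*): every closed connected smooth `4`-manifold carries a self-indexing Morse function
with exactly one critical point of index `0`, exactly one of index `4`, and as many of index `1`
as of index `3` — `exists_isSelfIndexing_ncard_one_eq_ncard_three_of_modelChart` fed with the
tree's theorem `Cobordism.Milnor1965_cancellation_modelChart_holds` (equivalently
`exists_isSelfIndexing_ncard_one_eq_ncard_three` fed with the discharged step 1,
`exists_isMorse_isSelfIndexing_holds 4`: Smale 1961, Milnor 1965 Thms. 4.8 and 8.1).  What
remains of the printed proof of Thm. 4 over `IsBalancedGKTrisection` is step 3 of the module
docstring (the Heegaard splitting of `∂X₁` adapted to the attaching link of the `2`-handles, and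
Lemma 14).
[cite: GayKirby2016, proof of Thm. 4 in §4, first two sentences]
[cite: MilnorHCobordism1965, Thm. 4.8 (PDF p. 25), Lemma 8.2 and proof of Thm. 8.1 (PDF pp. 54–57)] -/
theorem exists_isSelfIndexing_balanced (X : Type u) [TopologicalSpace X]
    [T2Space X] [SecondCountableTopology X] [ChartedSpace (EuclideanSpace ℝ (Fin 4)) X]
    [IsManifold (𝓡 4) ∞ X] [CompactSpace X] [ConnectedSpace X] :
    ∃ f : X → ℝ, IsMorse (𝓡 4) f ∧ IsSelfIndexing (𝓡 4) f ∧
      (criticalSetOfIndex (𝓡 4) f 0).ncard = 1 ∧ (criticalSetOfIndex (𝓡 4) f 4).ncard = 1 ∧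
      (criticalSetOfIndex (𝓡 4) f 1).ncard = (criticalSetOfIndex (𝓡 4) f 3).ncard :=
  exists_isSelfIndexing_ncard_one_eq_ncard_three_of_modelChart
    Cobordism.Milnor1965_cancellation_modelChart_holds X

end Balancing

end Literature.Topology.FourManifolds

end
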